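import Mathlib.Data.NNReal.Basic
import Mathlib.Algebra.Order.Floor.Semiring
import Mathlib.Algebra.Group.Equiv.Basic
import Mathlib.Tactic.FieldSimp
import Mathlib.Tactic.Positivity
import Mathlib.Tactic.Linarith
import HarnessLib

/-!
# Rigidity of the realified rank-one monoid `ℝ≥0`: additive self-maps are linear

[IUTchII] Proposition 4.2 (ii) (kurims Dec-2020 manuscript p. 124) and Proposition 4.4 (ii)
(p. 130) assert, for the realifications `Ψ^R_{†F^⊢_v} := (Ψ_{†F^⊢_v}/Ψ^×_{†F^⊢_v})^rlf` and
`Ψ^R_cns(−) ⥲ ℝ_{≥0}(−)` — both copies of the additive monoid `ℝ_{≥0}` equipped with a distinguished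
nonzero element — that "there exists a unique isomorphism of monoids `Ψ^R_{†F^⊢_v} ⥲ Ψ^R_cns(†G_v)` that
maps the distinguished element … to the distinguished element" [cite: Mochizuki2012, Prop 4.2 (ii) p.124].
The mathematical content of the uniqueness is the following rigidity of `ℝ≥0`, proved here from
Mathlib: every additive map `f : ℝ≥0 →+ ℝ≥0` is multiplication by `f 1` (additivity forces
monotonicity, `ℚ≥0`-homogeneity, and then linearity by a floor sandwich), hence an additive
isomorphism of `ℝ≥0` is determined by the image of any one nonzero element. This discharges the
statement `PointedHalfLine.IsoUnique` of the file on Propositions 4.2/4.4 (the one-line deduction is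
filed separately once that file is in the tree). Nothing here is specific to the disputed parts of
[IUTchII]; it is elementary real analysis recorded at the page that uses it.
-/

namespace Literature.IUT.HodgeArakelov

open scoped NNReal

namespace NNRealAddHom

variable (f : ℝ≥0 →+ ℝ≥0)

/-- An additive self-map of `ℝ≥0` is monotone (used for the uniqueness in [IUTchII] Prop 4.2 (ii)
p. 124). [cite: Mochizuki2012, Prop 4.2 (ii) p.124] -/
theorem monotone : Monotone f := by
  intro x y h
  obtain ⟨d, rfl⟩ := exists_add_of_le h
  rw [map_add]
  exact le_self_add

/-- An additive self-map of `ℝ≥0` commutes with division by a positive natural number.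
[cite: Mochizuki2012, Prop 4.2 (ii) p.124] -/
theorem map_div_nat (x : ℝ≥0) {n : ℕ} (hn : n ≠ 0) : f (x / n) = f x / n := by
  have hn' : (n : ℝ≥0) ≠ 0 := by exact_mod_cast hn
  have h := map_nsmul f n (x / n)
  rw [nsmul_eq_mul, nsmul_eq_mul, mul_div_cancel₀ _ hn'] at h
  rw [h]
  field_simp

/-- An additive self-map of `ℝ≥0` is `ℚ≥0`-homogeneous on `1`: `f (m/n) = (m/n) · f 1`.
[cite: Mochizuki2012, Prop 4.2 (ii) p.124] -/
theorem map_nat_div_nat (m : ℕ) {n : ℕ} (hn : n ≠ 0) :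
    f ((m : ℝ≥0) / n) = (m : ℝ≥0) / n * f 1 := by
  rw [map_div_nat f _ hn]
  have hm : f (m : ℝ≥0) = (m : ℝ≥0) * f 1 := by
    have := map_nsmul f m 1
    rwa [nsmul_eq_mul, nsmul_eq_mul, mul_one] at this
  rw [hm]
  ring

/-- `a ≤ b` as soon as `a ≤ b + c/n` for all `n ≥ 1` (archimedean sandwich in `ℝ≥0`; private
helper). [folklore] -/
private theorem le_of_forall_le_add_div_nat (a b c : ℝ≥0) (h : ∀ n : ℕ, 0 < n → a ≤ b + c / n) :
    a ≤ b := by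
  rw [← NNReal.coe_le_coe]
  refine le_of_forall_pos_lt_add fun ε hε => ?_
  obtain ⟨n, hn⟩ := exists_nat_gt ((c : ℝ) / ε)
  have hnpos : (0 : ℝ) < n := lt_of_le_of_lt (by positivity) hn
  have hn' : 0 < n := by exact_mod_cast hnpos
  have key : (a : ℝ) ≤ b + c / n := by exact_mod_cast h n hn'
  have hcn : (c : ℝ) / n < ε := by
    rw [div_lt_iff₀ hnpos]
    rw [div_lt_iff₀ hε] at hn
    linarith
  linarith

/-- **Rigidity of `ℝ≥0`** (the content of "a unique isomorphism of monoids … that maps the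
distinguished element … to the distinguished element", [IUTchII] Prop 4.2 (ii) p. 124, Prop 4.4 (ii)
p. 130): every additive map `f : ℝ≥0 →+ ℝ≥0` is `x ↦ x · f 1`.
[cite: Mochizuki2012, Prop 4.2 (ii) p.124] -/
theorem apply_eq_mul_map_one (x : ℝ≥0) : f x = x * f 1 := by
  set c := f 1 with hc
  -- floor sandwich at scale `1/n`
  have sandwich : ∀ n : ℕ, 0 < n →
      f x ≤ x * c + c / n ∧ x * c ≤ f x + c / n := by
    intro n hn
    have hn0 : (n : ℝ≥0) ≠ 0 := by exact_mod_cast hn.ne'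
    have hnpos : (0 : ℝ≥0) < n := by exact_mod_cast hn
    set m := ⌊x * n⌋₊ with hm
    have hlow : (m : ℝ≥0) / n ≤ x := by
      rw [div_le_iff₀ hnpos]
      exact Nat.floor_le zero_le
    have hup : x ≤ ((m + 1 : ℕ) : ℝ≥0) / n := by
      rw [le_div_iff₀ hnpos]
      exact_mod_cast (Nat.lt_floor_add_one (x * n)).le
    have f_up : f x ≤ ((m + 1 : ℕ) : ℝ≥0) / n * c := by
      have := monotone f hup
      rwa [map_nat_div_nat f _ hn.ne'] at this
    have f_low : (m : ℝ≥0) / n * c ≤ f x := by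
      have := monotone f hlow
      rwa [map_nat_div_nat f _ hn.ne'] at this
    have split : ((m + 1 : ℕ) : ℝ≥0) / n * c = (m : ℝ≥0) / n * c + c / n := by
      push_cast
      field_simp
    constructor
    · calc f x ≤ ((m + 1 : ℕ) : ℝ≥0) / n * c := f_up
        _ = (m : ℝ≥0) / n * c + c / n := split
        _ ≤ x * c + c / n := by gcongr
    · calc x * c ≤ ((m + 1 : ℕ) : ℝ≥0) / n * c := by gcongr
        _ = (m : ℝ≥0) / n * c + c / n := split
        _ ≤ f x + c / n := by gcongr
  apply le_antisymm
  · exact le_of_forall_le_add_div_nat _ _ _ fun n hn => (sandwich n hn).1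
  · exact le_of_forall_le_add_div_nat _ _ _ fun n hn => (sandwich n hn).2

/-- Two additive self-maps of `ℝ≥0` that agree at one nonzero point agree everywhere
([IUTchII] Prop 4.2 (ii) p. 124: the isomorphism matching the distinguished elements is unique).
[cite: Mochizuki2012, Prop 4.2 (ii) p.124] -/
theorem eq_of_apply_eq (g : ℝ≥0 →+ ℝ≥0) {a : ℝ≥0} (ha : a ≠ 0) (h : f a = g a) : f = g := by
  have hf := apply_eq_mul_map_one f a
  have hg := apply_eq_mul_map_one g a
  have h1 : f 1 = g 1 := by
    have : a * f 1 = a * g 1 := by rw [← hf, ← hg, h]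
    exact mul_left_cancel₀ ha this
  ext x
  rw [apply_eq_mul_map_one f x, apply_eq_mul_map_one g x, h1]

/-- The same for additive isomorphisms: an isomorphism of monoids `ℝ≥0 ⥲ ℝ≥0` is determined by the
image of one nonzero element ([IUTchII] Prop 4.2 (ii) p. 124, Prop 4.4 (ii) p. 130).
[cite: Mochizuki2012, Prop 4.4 (ii) p.130] -/
theorem addEquiv_eq_of_apply_eq (e e' : ℝ≥0 ≃+ ℝ≥0) {a : ℝ≥0} (ha : a ≠ 0) (h : e a = e' a) :
    e = e' := by
  have := eq_of_apply_eq e.toAddMonoidHom e'.toAddMonoidHom ha h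
  exact AddEquiv.ext fun x => DFunLike.congr_fun this x

end NNRealAddHom

end Literature.IUT.HodgeArakelov
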